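import Mathlib.RingTheory.RootsOfUnity.Complex
import Literature.Computability.MetaComplexity.PolynomialModmCorrelation
import HarnessLib

/-!
# Cell qa-qnc0 — the residue-ELIMINATION game: correlation identity (E2) and the log-degree bound

Planner seat qa-qnc0-p2 (ROUND-1 §9, `HOME/qa-qnc0-p2/artefacts/RingFrameSketch.lean`, whose
definitions are repeated here verbatim) reduces the ring crux `RingHard 2` (`Targets.lean`) to a
game on `n` bits: an ELIMINATOR is a pair of Boolean functions `a b : {0,1}ⁿ → {0,1}`, read as
`E(u) = a(u) + ω·b(u) ∈ 𝔽₄`; it FAILS at `u` iff `E(u) ∈ {0, ω^{r(u)}}` where the residue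
`r(u) = (c - |u|) mod 3` depends only on the Hamming weight `|u|` modulo `3`
(`elimFailBits`: residue `0`: fail iff `b u = 0`; residue `1`: fail iff `a u = 0`; residue `2`:
fail iff `a u = b u`). The trivial strategies fail on a `1/3`-fraction; the cell's question is
whether polylog-degree `𝔽₂`-polynomial eliminators can do better than a constant failure rate.

Proved here:

* `elimCorr_identity` (**E2**, for every target class `c`):
  `|fail(a,b)/2ⁿ − (1/3 + (2/3)·P[a = b = 0])| ≤ M + 2⁻ⁿ ≤ (3/2)(M + 2⁻ⁿ)`,
  `M = max{C(a), C(b), C(a ⊕ b)}`, `C(q) = |𝔼_u (−1)^{q(u)} ζ₃^{|u|}|` the complex `MOD₃`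
  correlation of Green 2004 / Viola–Wigderson 2008 (`corrMod3`). Proof: the root-of-unity filter
  `[|u| ≡ m (3)] = (1/3)Σ_t ζ^{t(|u|−m)}`, `|1 + ζ| = |1 + ζ²| = 1`, and
  `[b=0] + [a=0] + [a⊕b=0] = 1 + 2[a=b=0]` pointwise; `elimCorrLemma` is p2's `ElimCorrLemma`
  verbatim (`c = 0`).
* (sequel `EliminationLogDegree.lean`: `elimLogDegreeBound` — the unconditional log-degree lower
  bound from E2 + Viola–Wigderson — and the `ω`-rotation lemmas moving the target class.)

WHAT THIS IS NOT: nothing here reaches polylog degree (that is `ElimConst`/`CorrMod3`, open); the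
transfer from the ring to the elimination game (`RingToElim`, E1) is not in this file.
-/

noncomputable section

open Finset
open scoped ComplexConjugate

open Literature.Computability.MetaComplexity Literature.Computability.MetaComplexity.Smolensky
open Literature.Computability.MetaComplexity.GowersCube

namespace Summit.QuantumAdvantage.AdviceFreeQNC0

/-! ### The elimination game (planner qa-qnc0-p2, verbatim) -/

variable {n : ℕ}

/-- Hamming weight. -/
def wt (u : Fin n → Bool) : ℕ := (univ.filter fun i : Fin n => u i = true).card

/-- Failure table of the elimination game: residue `r = (c - w) mod 3`; `r = 0`: fail iff `β = 0`;
`r = 1`: fail iff `α = 0`; `r = 2`: fail iff `α = β` (`E = α + ωβ ∈ {0, ω^r}`). -/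
def elimFailBits (c : ℕ) (α β : Bool) (w : ℕ) : Bool :=
  if (c % 3 + 3 - w % 3) % 3 = 0 then !β else if (c % 3 + 3 - w % 3) % 3 = 1 then !α else (α == β)

/-- Failure of the eliminator `(a, b)` at `u` (target class `c`). -/
def elimFail (c : ℕ) (a b : (Fin n → Bool) → Bool) (u : Fin n → Bool) : Bool :=
  elimFailBits c (a u) (b u) (wt u)

/-- Number of failures of `(a, b)`. -/
def elimFailCount (c : ℕ) (a b : (Fin n → Bool) → Bool) : ℕ :=
  (univ.filter fun u : Fin n → Bool => elimFail c a b u = true).card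

/-- `#{u : a u = b u = 0}`. -/
def p00 (a b : (Fin n → Bool) → Bool) : ℕ :=
  (univ.filter fun u : Fin n → Bool => a u = false ∧ b u = false).card

/-- `ζ₃ = e^{2πi/3}`. -/
def zeta3 : ℂ := Complex.exp (2 * Real.pi * Complex.I / 3)

/-- The complex `MOD₃` correlation `C(q) = |𝔼_u (−1)^{q(u)} ζ₃^{|u|}|`
(Green 2004; Viola–Wigderson 2008; Ivanov–Pavlovic–Viola 2023). -/
def corrMod3 (q : (Fin n → Bool) → Bool) : ℝ :=
  ‖(∑ u : Fin n → Bool, (if q u then (-1 : ℂ) else 1) * zeta3 ^ wt u) / (2 : ℂ) ^ n‖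

/-- A Boolean function has `𝔽₂`-degree `≤ d` (through the tree's `Smolensky.lowDeg`). -/
def HasDeg (f : (Fin n → Bool) → Bool) (d : ℕ) : Prop :=
  (fun x => if f x then (1 : ZMod 2) else 0) ∈ lowDeg (ZMod 2) n d

/-! ### The cube root of unity -/

/-- `ζ₃` is a primitive cube root of unity. -/
private theorem zeta3_prim : IsPrimitiveRoot zeta3 3 := by
  have h := Complex.isPrimitiveRoot_exp 3 (by norm_num)
  convert h using 2
  unfold zeta3
  push_cast
  ring_nf

/-- `ζ₃³ = 1`. -/
private theorem zeta3_pow_three : zeta3 ^ 3 = 1 := zeta3_prim.pow_eq_one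

/-- `‖ζ₃‖ = 1`. -/
theorem zeta3_norm : ‖zeta3‖ = 1 := zeta3_prim.norm'_eq_one (by norm_num)

/-- `ζ₃ ≠ 0`. -/
private theorem zeta3_ne_zero : zeta3 ≠ 0 := fun h => by
  have := zeta3_norm; rw [h, norm_zero] at this; exact zero_ne_one this

/-- `1 + ζ + ζ² = 0`. -/
private theorem zeta3_sum : 1 + zeta3 + zeta3 ^ 2 = 0 := by
  have h := zeta3_prim.geom_sum_eq_zero (by norm_num : 1 < 3)
  simpa [Finset.sum_range_succ, add_assoc] using h

/-- `conj ζ = ζ²`. -/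
private theorem conj_zeta3 : conj zeta3 = zeta3 ^ 2 := by
  have h1 : zeta3 * conj zeta3 = 1 := by
    rw [Complex.mul_conj, Complex.normSq_eq_norm_sq, zeta3_norm]; norm_num
  have h2 : zeta3 * zeta3 ^ 2 = 1 := by rw [← pow_succ', zeta3_pow_three]
  exact mul_left_cancel₀ zeta3_ne_zero (h1.trans h2.symm)

/-- `Re ζ = −1/2` (real part of `1 + ζ + conj ζ = 0`). -/
private theorem zeta3_re : zeta3.re = -1 / 2 := by
  have h := congrArg Complex.re zeta3_sum
  rw [← conj_zeta3] at h
  simp only [Complex.add_re, Complex.one_re, Complex.conj_re, Complex.zero_re] at h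
  linarith

/-- `Re ζ² = −1/2`. -/
private theorem zeta3_sq_re : (zeta3 ^ 2).re = -1 / 2 := by
  rw [← conj_zeta3, Complex.conj_re, zeta3_re]

/-- Powers reduce modulo `3`. -/
private theorem zeta3_pow_mod (m : ℕ) : zeta3 ^ m = zeta3 ^ (m % 3) := by
  conv_lhs => rw [← Nat.div_add_mod m 3, pow_add, pow_mul, zeta3_pow_three, one_pow, one_mul]

/-- `Re ζ^{2^d} = −1/2` (as `3 ∤ 2^d`). -/
theorem zeta3_two_pow_re (d : ℕ) : (zeta3 ^ 2 ^ d).re = -1 / 2 := by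
  rw [zeta3_pow_mod]
  have h3 : 2 ^ d % 3 = 1 ∨ 2 ^ d % 3 = 2 := by
    induction d with
    | zero => left; norm_num
    | succ k ih => rcases ih with h | h <;> [right; left] <;> rw [pow_succ, Nat.mul_mod, h]
  rcases h3 with h | h
  · rw [h, pow_one, zeta3_re]
  · rw [h, zeta3_sq_re]

/-- `‖1 + ζ‖ = 1` and `‖1 + ζ²‖ = 1`. -/
private theorem norm_one_add_zeta3_pow {t : ℕ} (ht : t = 1 ∨ t = 2) : ‖1 + zeta3 ^ t‖ = 1 := by
  rcases ht with rfl | rfl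
  · have : 1 + zeta3 ^ 1 = -(zeta3 ^ 2) := by rw [pow_one]; linear_combination zeta3_sum
    rw [this, norm_neg, norm_pow, zeta3_norm, one_pow]
  · have : 1 + zeta3 ^ 2 = -zeta3 := by linear_combination zeta3_sum
    rw [this, norm_neg, zeta3_norm]

/-- **Root-of-unity filter**: `Σ_{t<3} ζ^{t·m} = 3·[3 ∣ m]`. -/
private theorem filter_sum (m : ℕ) :
    (∑ t ∈ range 3, zeta3 ^ (t * m)) = if m % 3 = 0 then 3 else 0 := by
  have hpow : ∀ t, zeta3 ^ (t * m) = (zeta3 ^ (m % 3)) ^ t := fun t => by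
    rw [← zeta3_pow_mod, ← pow_mul, mul_comm]
  simp only [hpow, Finset.sum_range_succ, Finset.sum_range_zero, zero_add, pow_zero, pow_one]
  have hm : m % 3 < 3 := Nat.mod_lt _ (by norm_num)
  interval_cases h : m % 3
  · norm_num
  · rw [if_neg (by norm_num), pow_one]
    linear_combination zeta3_sum
  · rw [if_neg (by norm_num)]
    have : (zeta3 ^ 2) ^ 2 = zeta3 := by
      rw [← pow_mul, show 2 * 2 = 3 + 1 by norm_num, pow_add, zeta3_pow_three, one_mul, pow_one]
    rw [this]
    linear_combination zeta3_sum

/-! ### Character sums over the cube -/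

/-- `Σ_u ζ^{t|u|} = (1 + ζ^t)ⁿ`. -/
private theorem sum_zeta_pow_wt (z : ℂ) : (∑ u : Fin n → Bool, z ^ wt u) = (1 + z) ^ n := by
  have h : ∀ u : Fin n → Bool, z ^ wt u = ∏ i, (if u i = true then z else 1) := fun u => by
    unfold wt
    rw [← Finset.prod_filter, Finset.prod_const]
  simp_rw [h]
  rw [← Fintype.prod_sum fun (_ : Fin n) (b : Bool) => if b = true then z else (1 : ℂ)]
  simp [add_comm]

/-- The sign `(−1)^{q(u)}`. -/
private def sgn (q : (Fin n → Bool) → Bool) (u : Fin n → Bool) : ℂ := if q u then -1 else 1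

/-- `[q u = 0] = (1 + (−1)^{q u})/2`. -/
private theorem indicator_false_eq (q : (Fin n → Bool) → Bool) (u : Fin n → Bool) :
    (if q u = false then (1 : ℂ) else 0) = (1 + sgn q u) / 2 := by
  unfold sgn; cases q u <;> simp

/-- `‖Σ_u (−1)^{q(u)} ζ^{t|u|}‖ = 2ⁿ·C(q)` for `t = 1, 2` (`t = 2` is the complex conjugate). -/
private theorem norm_signed_sum_le (q : (Fin n → Bool) → Bool) {t : ℕ} (ht : t = 1 ∨ t = 2) :
    ‖∑ u : Fin n → Bool, sgn q u * zeta3 ^ (t * wt u)‖ = 2 ^ n * corrMod3 q := by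
  have h2n : (0 : ℝ) < 2 ^ n := by positivity
  have hC : corrMod3 q = ‖∑ u : Fin n → Bool, sgn q u * zeta3 ^ wt u‖ / 2 ^ n := by
    unfold corrMod3 sgn
    rw [norm_div, norm_pow, Complex.norm_ofNat]
  rw [hC, mul_div_cancel₀ _ h2n.ne']
  rcases ht with rfl | rfl
  · simp only [one_mul]
  · -- conjugate
    have hconj : (∑ u : Fin n → Bool, sgn q u * zeta3 ^ (2 * wt u)) =
        conj (∑ u : Fin n → Bool, sgn q u * zeta3 ^ wt u) := by
      rw [map_sum]
      refine Finset.sum_congr rfl fun u _ => ?_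
      rw [map_mul, map_pow, conj_zeta3, ← pow_mul]
      congr 1
      unfold sgn; split_ifs <;> simp
    rw [hconj, Complex.norm_conj]

/-- **Equidistribution lemma**: for every Boolean `q` and shift `m`,
`‖3·#{u : 3 ∣ |u|+m, q u = 0} − #{u : q u = 0}‖ ≤ 1 + 2ⁿ·C(q)`. -/
private theorem three_mul_card_filter_sub_le (q : (Fin n → Bool) → Bool) (m : ℕ) :
    ‖(3 * ((univ.filter fun u : Fin n → Bool => (wt u + m) % 3 = 0 ∧ q u = false).card : ℂ)) -
        ((univ.filter fun u : Fin n → Bool => q u = false).card : ℂ)‖ ≤ 1 + 2 ^ n * corrMod3 q := by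
  -- expand the residue indicator by the filter
  have hexp : (3 * ((univ.filter fun u : Fin n → Bool => (wt u + m) % 3 = 0 ∧ q u = false).card : ℂ)) =
      ∑ u : Fin n → Bool, (if q u = false then (1 : ℂ) else 0) *
        ∑ t ∈ range 3, zeta3 ^ (t * (wt u + m)) := by
    rw [natCast_card_filter, Finset.mul_sum]
    refine Finset.sum_congr rfl fun u _ => ?_
    rw [filter_sum]
    by_cases h1 : (wt u + m) % 3 = 0 <;> by_cases h2 : q u = false <;> simp [h1, h2]
  -- split the `t`-sum: `t = 0` gives the main term
  have hsplit : ∀ u : Fin n → Bool, (∑ t ∈ range 3, zeta3 ^ (t * (wt u + m))) =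
      1 + (zeta3 ^ (1 * m) * zeta3 ^ (1 * wt u) + zeta3 ^ (2 * m) * zeta3 ^ (2 * wt u)) := fun u => by
    simp only [Finset.sum_range_succ, Finset.sum_range_zero, zero_add, zero_mul, pow_zero]
    rw [add_assoc]
    congr 1
    rw [← pow_add, ← pow_add]
    congr 1 <;> ring
  simp_rw [hsplit, mul_add, mul_one, Finset.sum_add_distrib] at hexp
  rw [hexp, ← natCast_card_filter, add_sub_cancel_left]
  -- the two error terms
  have hterm : ∀ t : ℕ, (t = 1 ∨ t = 2) →
      ‖∑ u : Fin n → Bool, (if q u = false then (1 : ℂ) else 0) * (zeta3 ^ (t * m) * zeta3 ^ (t * wt u))‖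
        ≤ (1 + 2 ^ n * corrMod3 q) / 2 := by
    intro t ht
    have hre : (∑ u : Fin n → Bool, (if q u = false then (1 : ℂ) else 0) * (zeta3 ^ (t * m) * zeta3 ^ (t * wt u))) =
        zeta3 ^ (t * m) / 2 * ((∑ u : Fin n → Bool, (zeta3 ^ t) ^ wt u) +
          ∑ u : Fin n → Bool, sgn q u * zeta3 ^ (t * wt u)) := by
      rw [← Finset.sum_add_distrib, Finset.mul_sum]
      refine Finset.sum_congr rfl fun u _ => ?_
      rw [indicator_false_eq, ← pow_mul]
      ring
    rw [hre, norm_mul, norm_div, norm_pow, zeta3_norm, one_pow, Complex.norm_ofNat,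
      sum_zeta_pow_wt]
    refine le_trans (mul_le_mul_of_nonneg_left (norm_add_le _ _) (by norm_num)) ?_
    rw [norm_pow, norm_one_add_zeta3_pow ht, one_pow, norm_signed_sum_le q ht]
    linarith
  calc ‖(∑ u : Fin n → Bool, (if q u = false then (1 : ℂ) else 0) * (zeta3 ^ (1 * m) * zeta3 ^ (1 * wt u))) +
        ∑ u : Fin n → Bool, (if q u = false then (1 : ℂ) else 0) * (zeta3 ^ (2 * m) * zeta3 ^ (2 * wt u))‖
      ≤ (1 + 2 ^ n * corrMod3 q) / 2 + (1 + 2 ^ n * corrMod3 q) / 2 :=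
        (norm_add_le _ _).trans (add_le_add (hterm 1 (Or.inl rfl)) (hterm 2 (Or.inr rfl)))
    _ = 1 + 2 ^ n * corrMod3 q := by ring

/-! ### E2: the correlation identity -/

/-- The residue selecting which failure rule applies. -/
private def res (c w : ℕ) : ℕ := (c % 3 + 3 - w % 3) % 3

/-- The residue is `< 3`. -/
private theorem res_lt (c w : ℕ) : res c w < 3 := Nat.mod_lt _ (by norm_num)

/-- `res c w = j ↔ 3 ∣ w + (j + 3 − c % 3)` for `j < 3`. -/
private theorem res_eq_iff (c w j : ℕ) (hj : j < 3) :
    res c w = j ↔ (w + (j + 3 - c % 3)) % 3 = 0 := by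
  unfold res
  have hc : c % 3 < 3 := Nat.mod_lt _ (by norm_num)
  have hw : w % 3 < 3 := Nat.mod_lt _ (by norm_num)
  omega

/-- The failure predicate, by residue. -/
private theorem elimFail_iff (c : ℕ) (a b : (Fin n → Bool) → Bool) (u : Fin n → Bool) :
    elimFail c a b u = true ↔
      (res c (wt u) = 0 ∧ b u = false) ∨ (res c (wt u) = 1 ∧ a u = false) ∨
        (res c (wt u) = 2 ∧ (xor (a u) (b u)) = false) := by
  unfold elimFail elimFailBits
  rw [show (c % 3 + 3 - wt u % 3) % 3 = res c (wt u) from rfl]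
  have hr := res_lt c (wt u)
  interval_cases h : res c (wt u) <;> cases a u <;> cases b u <;> simp

/-- Pointwise: `[b=0] + [a=0] + [a⊕b=0] = 1 + 2[a=b=0]`. -/
private theorem three_indicators (α β : Bool) :
    ((if β = false then 1 else 0 : ℕ) + (if α = false then 1 else 0) +
        (if (xor α β) = false then 1 else 0)) = 1 + 2 * (if α = false ∧ β = false then 1 else 0) := by
  cases α <;> cases β <;> simp

/-- **E2 — the correlation identity of the elimination game**, for every target class `c`:
`|fail(a,b)/2ⁿ − (1/3 + (2/3)·#{a=b=0}/2ⁿ)| ≤ max{C(a), C(b), C(a⊕b)} + 2⁻ⁿ`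
(planner qa-qnc0-p2, ROUND-1 §9.5, sharpened constant). -/
theorem elimCorr_identity (c : ℕ) (a b : (Fin n → Bool) → Bool) :
    |(elimFailCount c a b : ℝ) / 2 ^ n - (1 / 3 + 2 / 3 * ((p00 a b : ℝ) / 2 ^ n))|
      ≤ max (corrMod3 a) (max (corrMod3 b) (corrMod3 fun u => xor (a u) (b u))) + 1 / 2 ^ n := by
  set xab : (Fin n → Bool) → Bool := fun u => xor (a u) (b u) with hxab
  set M := max (corrMod3 a) (max (corrMod3 b) (corrMod3 xab)) with hM
  have h2n : (0 : ℝ) < 2 ^ n := by positivity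
  -- the three residue counts
  set A0 := (univ.filter fun u : Fin n → Bool => (wt u + (0 + 3 - c % 3)) % 3 = 0 ∧ b u = false).card
  set A1 := (univ.filter fun u : Fin n → Bool => (wt u + (1 + 3 - c % 3)) % 3 = 0 ∧ a u = false).card
  set A2 := (univ.filter fun u : Fin n → Bool => (wt u + (2 + 3 - c % 3)) % 3 = 0 ∧ xab u = false).card
  have hcount : elimFailCount c a b = A0 + A1 + A2 := by
    unfold elimFailCount
    rw [← Finset.card_union_of_disjoint, ← Finset.card_union_of_disjoint]
    · congr 1
      ext u
      simp only [mem_filter, mem_univ, true_and, mem_union, elimFail_iff,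
        res_eq_iff c (wt u) 0 (by norm_num), res_eq_iff c (wt u) 1 (by norm_num),
        res_eq_iff c (wt u) 2 (by norm_num), hxab, or_assoc]
    · rw [Finset.disjoint_left]
      intro u hu hu'
      rw [mem_union, mem_filter, mem_filter] at hu
      rw [mem_filter] at hu'
      have hc3 : c % 3 < 3 := Nat.mod_lt _ (by norm_num)
      rcases hu with ⟨-, h, -⟩ | ⟨-, h, -⟩ <;> omega
    · rw [Finset.disjoint_left]
      intro u hu hu'
      rw [mem_filter] at hu hu'
      have hc3 : c % 3 < 3 := Nat.mod_lt _ (by norm_num)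
      omega
  -- the main terms add up to `2ⁿ + 2·p00`
  have hmain : ((univ.filter fun u : Fin n → Bool => b u = false).card +
      (univ.filter fun u : Fin n → Bool => a u = false).card +
      (univ.filter fun u : Fin n → Bool => xab u = false).card : ℕ) = 2 ^ n + 2 * p00 a b := by
    unfold p00
    rw [card_filter, card_filter, card_filter, card_filter, ← Finset.sum_add_distrib,
      ← Finset.sum_add_distrib, Finset.mul_sum]
    rw [show (2 : ℕ) ^ n = ∑ _u : Fin n → Bool, 1 by simp, ← Finset.sum_add_distrib]
    refine Finset.sum_congr rfl fun u _ => ?_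
    rw [hxab]
    exact three_indicators (a u) (b u)
  -- the complex error estimate
  have herr : ‖(3 * (elimFailCount c a b : ℂ)) - ((2 ^ n + 2 * p00 a b : ℕ) : ℂ)‖ ≤
      3 + 2 ^ n * (corrMod3 a + corrMod3 b + corrMod3 xab) := by
    rw [← hmain, hcount]
    push_cast
    have e0 := three_mul_card_filter_sub_le b (0 + 3 - c % 3)
    have e1 := three_mul_card_filter_sub_le a (1 + 3 - c % 3)
    have e2 := three_mul_card_filter_sub_le xab (2 + 3 - c % 3)
    calc ‖3 * ((A0 : ℂ) + (A1 : ℂ) + (A2 : ℂ)) -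
          (((univ.filter fun u : Fin n → Bool => b u = false).card : ℂ) +
            ((univ.filter fun u : Fin n → Bool => a u = false).card : ℂ) +
            ((univ.filter fun u : Fin n → Bool => xab u = false).card : ℂ))‖
        = ‖(3 * (A0 : ℂ) - ((univ.filter fun u : Fin n → Bool => b u = false).card : ℂ)) +
            (3 * (A1 : ℂ) - ((univ.filter fun u : Fin n → Bool => a u = false).card : ℂ)) +
            (3 * (A2 : ℂ) - ((univ.filter fun u : Fin n → Bool => xab u = false).card : ℂ))‖ := by
          ring_nf
      _ ≤ (1 + 2 ^ n * corrMod3 b) + (1 + 2 ^ n * corrMod3 a) + (1 + 2 ^ n * corrMod3 xab) :=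
          (norm_add₃_le).trans (add_le_add (add_le_add e0 e1) e2)
      _ = 3 + 2 ^ n * (corrMod3 a + corrMod3 b + corrMod3 xab) := by ring
  -- pass to the reals
  have hreal : |3 * (elimFailCount c a b : ℝ) - (2 ^ n + 2 * p00 a b : ℝ)| ≤
      3 + 2 ^ n * (corrMod3 a + corrMod3 b + corrMod3 xab) := by
    have : ‖((3 * (elimFailCount c a b : ℝ) - (2 ^ n + 2 * p00 a b : ℝ) : ℝ) : ℂ)‖ ≤
        3 + 2 ^ n * (corrMod3 a + corrMod3 b + corrMod3 xab) := by
      convert herr using 2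
      push_cast
      ring
    rwa [Complex.norm_real, Real.norm_eq_abs] at this
  have hCa : corrMod3 a ≤ M := le_max_left _ _
  have hCb : corrMod3 b ≤ M := (le_max_left _ _).trans (le_max_right _ _)
  have hCx : corrMod3 xab ≤ M := (le_max_right _ _).trans (le_max_right _ _)
  have hsum3 : corrMod3 a + corrMod3 b + corrMod3 xab ≤ 3 * M := by linarith
  -- divide by `3·2ⁿ`
  have key : |(elimFailCount c a b : ℝ) / 2 ^ n - (1 / 3 + 2 / 3 * ((p00 a b : ℝ) / 2 ^ n))| =
      |3 * (elimFailCount c a b : ℝ) - (2 ^ n + 2 * p00 a b : ℝ)| / (3 * 2 ^ n) := by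
    rw [show (elimFailCount c a b : ℝ) / 2 ^ n - (1 / 3 + 2 / 3 * ((p00 a b : ℝ) / 2 ^ n)) =
        (3 * (elimFailCount c a b : ℝ) - (2 ^ n + 2 * p00 a b : ℝ)) / (3 * 2 ^ n) by
      field_simp]
    rw [abs_div, abs_of_pos (by positivity : (0 : ℝ) < 3 * 2 ^ n)]
  rw [key, div_le_iff₀ (by positivity)]
  calc |3 * (elimFailCount c a b : ℝ) - (2 ^ n + 2 * p00 a b : ℝ)|
      ≤ 3 + 2 ^ n * (corrMod3 a + corrMod3 b + corrMod3 xab) := hreal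
    _ ≤ 3 + 2 ^ n * (3 * M) := by
        have : (0 : ℝ) ≤ 2 ^ n := h2n.le
        nlinarith
    _ = (M + 1 / 2 ^ n) * (3 * 2 ^ n) := by field_simp; ring

/-- **`ElimCorrLemma`** (planner qa-qnc0-p2's typed statement, verbatim; constant `3/2`). -/
theorem elimCorrLemma : ∀ n : ℕ, ∀ a b : (Fin n → Bool) → Bool,
    |(elimFailCount 0 a b : ℝ) / 2 ^ n - (1 / 3 + 2 / 3 * ((p00 a b : ℝ) / 2 ^ n))|
      ≤ 3 / 2 * (max (corrMod3 a) (max (corrMod3 b) (corrMod3 fun u => xor (a u) (b u))) + 1 / 2 ^ n) := by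
  intro n a b
  refine (elimCorr_identity 0 a b).trans ?_
  have h1 : 0 ≤ max (corrMod3 a) (max (corrMod3 b) (corrMod3 fun u => xor (a u) (b u))) :=
    le_trans (norm_nonneg _) (le_max_left _ _)
  have h2 : (0 : ℝ) ≤ 1 / 2 ^ n := by positivity
  linarith

end Summit.QuantumAdvantage.AdviceFreeQNC0
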